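import Summits.NavierStokesRegularity.NavierStokesRegularity.Theorems.PerpetualPumpThesisBesovDuhamelBoundGamma
import Summits.NavierStokesRegularity.NavierStokesRegularity.Theorems.PerpetualPumpThesisBesovDuhamelBoundSlot
import Summits.NavierStokesRegularity.NavierStokesRegularity.Theorems.PerpetualPumpThesisBesovDuhamelBoundEuler
import Summits.NavierStokesRegularity.NavierStokesRegularity.Theorems.PerpetualPumpThesisBesovFloorBoundDuhamel
import Literature.Analysis.FluidPDE.TaoSymbolSeminormMeasurable

/-!
# Stub `besovDuhamelBound` for `PerpetualPump.Thesis`, part X: the key bilinear estimate and the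
# blocks of the Duhamel term

Support file (part 10 of the stub `besovDuhamelBound` of line `SketchIdeator2`, crux
stmt-NavierStokesRegularity-1832). For an arbitrary averaging datum `𝒜` (T. Tao, J. Amer. Math. Soc.
29 (2016), (1.12)–(1.15)) this file assembles parts IV (Euler form in physical space), VIII (slots
`Ḃ⁰_{∞,1} → L^∞`), IX (the kernels `𝓕⁻¹[ξ_jĤ_l]`) and Tao's moment bounds into **the key bilinear
estimate** (`FA.exists_enorm_form_heat_test_le`)

  `|⟨B̃(f,f), e^{σΔ} w_{k,x,i}⟩| ≤ K ‖f‖²_{Ḃ⁰_{∞,1}} 2ᵏ e^{-(π²/8) σ 4ᵏ}`,  `f ∈ H¹⁰_df`,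

with `K < ∞` depending only on `𝒜` (`𝔼 ∑‖m₁‖_a‖m₂‖_b‖m₃‖_c < ∞`), and feeds it, through the restarted
Duhamel identity of part Duhamel of stub F and the test fields of part VI, into the blockwise bound
of the Duhamel term of a mild `H¹⁰_df` solution on `[0,T)` (`FA.eLpNormDistrib_lpBlock_duhamel_le`):

  `‖Δ̇_k (u(t) - e^{(t-t₁)Δ}u(t₁))‖_{L^∞} ≤ 3 ∫_{t₁}^{t} K M² 2ᵏ e^{-(π²/8)(t-s)4ᵏ} ds`

whenever `‖u(s)‖_{Ḃ⁰_{∞,1}} ≤ M` on `[t₁, t]`.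

## References

* T. Tao, J. Amer. Math. Soc. 29 (2016), 601–674, §1.1 (1.12)–(1.15).
* H. Bahouri, J.-Y. Chemin, R. Danchin, *Fourier Analysis and Nonlinear PDE* (2011), §2.2, Lemma 2.4.
-/

noncomputable section

open MeasureTheory Filter Topology FourierTransform Real Complex Set
open scoped SchwartzMap ENNReal NNReal RealInnerProductSpace FourierTransform

set_option linter.dupNamespace false

namespace Summit.NavierStokesRegularity.NavierStokesRegularity.Theorems.PerpetualPumpThesis.FA

open Literature.Analysis.FunctionSpaces Literature.Analysis.FluidPDE
  Literature.Analysis.FluidPDE.Tao2016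

/-! ### `H¹⁰ ⊂ 𝓕L¹` and the slots -/

/-- A field of finite `H¹⁰` norm has integrable Fourier transform (`H¹⁰(ℝ³) ⊂ 𝓕L¹`, Cauchy–Schwarz
against `(1+|ξ|²)^{-10}`). -/
theorem integrable_fourierFn_of_sobolev {f : L2C} (hf : eFourierSobolevNorm 10 f < ⊤) :
    Integrable (fourierFn f) := by
  refine ⟨aestronglyMeasurable_fourierFn f, ?_⟩
  refine lt_of_le_of_lt (lintegral_enorm_le_sobolevWeight (aestronglyMeasurable_fourierFn f)) ?_
  refine ENNReal.mul_lt_top (ENNReal.rpow_lt_top_of_nonneg (by norm_num) lintegral_inv_sobolevWeight_lt_top.ne) ?_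
  rw [← eFourierSobolevNorm_eq]
  exact hf

/-- The slots of an averaging datum preserve divergence-freeness. -/
theorem isFourierDivFree_slot (𝒜 : AveragingDatum) (i : Fin 3) (θ : 𝒜.Ω) {f : L2C}
    (hf : IsFourierDivFree f) : IsFourierDivFree (𝒜.slot i θ f) :=
  ((hf.dil (𝒜.lam_pos i θ)).rot _).fourierMultiplier _

/-- `ofReal` of a sum of `toReal`s is at most the `ℝ≥0∞` sum. -/
theorem ofReal_sum_toReal_le {n : ℕ} (s : ℕ → ℝ≥0∞) :
    ENNReal.ofReal (∑ j ∈ Finset.range (n + 1), (s j).toReal) ≤ ∑ j ∈ Finset.range (n + 1), s j := by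
  rw [ENNReal.ofReal_sum_of_nonneg fun j _ => ENNReal.toReal_nonneg]
  exact Finset.sum_le_sum fun j _ => ENNReal.ofReal_toReal_le

/-! ### The moment constant -/

/-- **Tao's moment bounds sum up**: `∫ (∑_{a≤n₀}‖m₁‖_a)(∑_{b≤n₁}‖m₂‖_b)(∑_{c≤n₂}‖m₃‖_c) dμ < ∞`. -/
theorem lintegral_sum_symbolSeminorm_lt_top (𝒜 : AveragingDatum) (n₀ n₁ n₂ : ℕ) :
    ∫⁻ θ, (∑ a ∈ Finset.range (n₀ + 1), symbolSeminorm a (𝒜.m 0 θ)) *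
        (∑ b ∈ Finset.range (n₁ + 1), symbolSeminorm b (𝒜.m 1 θ)) *
        (∑ c ∈ Finset.range (n₂ + 1), symbolSeminorm c (𝒜.m 2 θ)) ∂𝒜.μ < ⊤ := by
  have hmeas : ∀ (i : Fin 3) (k : ℕ), Measurable fun θ => symbolSeminorm k (𝒜.m i θ) :=
    fun i k => 𝒜.measurable_symbolSeminorm i k
  have hterm : ∀ a b c, Measurable fun θ =>
      symbolSeminorm a (𝒜.m 0 θ) * symbolSeminorm b (𝒜.m 1 θ) * symbolSeminorm c (𝒜.m 2 θ) :=
    fun a b c => ((hmeas 0 a).mul (hmeas 1 b)).mul (hmeas 2 c)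
  simp_rw [Finset.sum_mul_sum, Finset.sum_mul]
  rw [lintegral_finsetSum _ fun a _ => Finset.measurable_sum _ fun c _ =>
    Finset.measurable_sum _ fun b _ => hterm a b c]
  refine ENNReal.sum_lt_top.2 fun a _ => ?_
  rw [lintegral_finsetSum _ fun c _ => Finset.measurable_sum _ fun b _ => hterm a b c]
  refine ENNReal.sum_lt_top.2 fun c _ => ?_
  rw [lintegral_finsetSum _ fun b _ => hterm a b c]
  exact ENNReal.sum_lt_top.2 fun b _ => 𝒜.moment a b c

/-! ### The key bilinear estimate -/

/-- **The key bilinear estimate of the Besov–Duhamel bound.** For every averaging datum `𝒜` there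
is `K < ∞` such that for every `f ∈ H¹⁰_df` with `‖f‖_{Ḃ⁰_{∞,1}} ≤ M_f`, every `σ ≥ 0`, `k ∈ ℤ`,
`x ∈ ℝ³`, `i` and every `w ∈ L²` with `ŵ(η) = e^{-2πi x·η} φ_k(η) P(η) e_i` a.e.,
`|⟨B̃(f,f), e^{σΔ} w⟩| ≤ K M_f² 2ᵏ e^{-(π²/8) σ 4ᵏ}` (Euler form in physical space, slots
`Ḃ⁰_{∞,1} → L^∞`, the kernels of part IX, and Tao's moment bounds). -/
theorem exists_enorm_form_heat_test_le (𝒜 : AveragingDatum) :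
    ∃ K : ℝ≥0∞, K ≠ ⊤ ∧ ∀ (f : L2C), MemH10df f → ∀ (Mf : ℝ≥0∞),
      eHomBesovNorm 0 ∞ 1 ((f : L2C) : 𝓢'(EuclideanSpace ℝ (Fin 3), EuclideanSpace ℂ (Fin 3))) ≤ Mf →
      ∀ (σ : ℝ), 0 ≤ σ → ∀ (k : ℤ) (x : EuclideanSpace ℝ (Fin 3)) (i : Fin 3) (w : L2C),
      (fourierFn w =ᵐ[volume] fun η : EuclideanSpace ℝ (Fin 3) =>
        ((𝐞 (-⟪x, η⟫) : ℂ) * dyadicSymbol k η) •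
          (EuclideanSpace.single i (1 : ℂ) -
            (EuclideanSpace.complexify η i / ((‖η‖ ^ 2 : ℝ) : ℂ)) • EuclideanSpace.complexify η)) →
      ‖𝒜.form f f (heat σ w)‖ₑ ≤
        K * Mf ^ 2 * ENNReal.ofReal ((2 : ℝ) ^ k * Real.exp (-(π ^ 2 / 8) * (σ * ((2 : ℝ) ^ k) ^ 2))) := by
  obtain ⟨ns, Cs, hCs⟩ := exists_eLpNorm_slot_le 𝒜
  obtain ⟨ng, Cg, hCg⟩ := exists_gamma 𝒜
  -- the random factor and its expectation
  set Sf : Fin 3 → ℕ → 𝒜.Ω → ℝ≥0∞ := fun i n θ => ∑ j ∈ Finset.range (n + 1), symbolSeminorm j (𝒜.m i θ)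
    with hSf
  have hSfm : ∀ i n, Measurable (Sf i n) := fun i n =>
    Finset.measurable_sum _ fun j _ => 𝒜.measurable_symbolSeminorm i j
  set Mom : ℝ≥0∞ := ∫⁻ θ, Sf 0 ns θ * Sf 1 ns θ * Sf 2 ng θ ∂𝒜.μ with hMom
  have hMomfin : Mom < ⊤ := lintegral_sum_symbolSeminorm_lt_top 𝒜 ns ns ng
  set c : ℝ≥0∞ := ENNReal.ofReal (2 * π) * Cs * Cs * (9 * Cg) with hc
  have hcfin : c ≠ ⊤ := by
    rw [hc]
    exact ENNReal.mul_ne_top (ENNReal.mul_ne_top (ENNReal.mul_ne_top ENNReal.ofReal_ne_top ENNReal.coe_ne_top)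
      ENNReal.coe_ne_top) (ENNReal.mul_ne_top (by norm_num) ENNReal.coe_ne_top)
  refine ⟨c * Mom, ENNReal.mul_ne_top hcfin hMomfin.ne, fun f hf Mf hMf σ hσ k x i w hw => ?_⟩
  set Ek : ℝ≥0∞ := ENNReal.ofReal ((2 : ℝ) ^ k * Real.exp (-(π ^ 2 / 8) * (σ * ((2 : ℝ) ^ k) ^ 2)))
    with hEk
  -- pointwise in `θ`
  have hpt : ∀ θ, ‖eulerForm (𝒜.slot 0 θ f) (𝒜.slot 1 θ f) (𝒜.slot 2 θ (heat σ w))‖ₑ ≤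
      c * Mf ^ 2 * Ek * (Sf 0 ns θ * Sf 1 ns θ * Sf 2 ng θ) := by
    intro θ
    obtain ⟨γ, hγf, hγb⟩ := hCg θ σ hσ k x i w hw
    have hF : IsFourierDivFree (𝒜.slot 0 θ f) := isFourierDivFree_slot 𝒜 0 θ hf.2.2
    have hG : IsFourierDivFree (𝒜.slot 1 θ f) := isFourierDivFree_slot 𝒜 1 θ hf.2.2
    have hFi : Integrable (fourierFn (𝒜.slot 0 θ f)) :=
      integrable_fourierFn_of_sobolev (𝒜.toComplex.eFourierSobolevNorm_slot_lt_top 0 θ hf.1)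
    have hE := enorm_eulerForm_le_of_schwartz hF hG hFi γ hγf
    have hslot : ∀ i' : Fin 3, eLpNorm ((𝒜.slot i' θ f : L2C) :
        EuclideanSpace ℝ (Fin 3) → EuclideanSpace ℂ (Fin 3)) ∞ volume ≤ Cs * Sf i' ns θ * Mf := by
      intro i'
      refine (hCs i' θ f).trans ?_
      gcongr
      exact ofReal_sum_toReal_le _
    have hγsum : ∑ j, ∑ l, eLpNorm (⇑(𝓕⁻ (γ j l) : 𝓢(EuclideanSpace ℝ (Fin 3), ℂ))) 1 volume ≤
        9 * Cg * Sf 2 ng θ * Ek := by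
      calc ∑ j, ∑ l, eLpNorm (⇑(𝓕⁻ (γ j l) : 𝓢(EuclideanSpace ℝ (Fin 3), ℂ))) 1 volume
          ≤ ∑ _j : Fin 3, ∑ _l : Fin 3, Cg * Sf 2 ng θ * Ek := by
            refine Finset.sum_le_sum fun j _ => Finset.sum_le_sum fun l _ => (hγb j l).trans ?_
            gcongr
            exact ofReal_sum_toReal_le _
        _ = 9 * Cg * Sf 2 ng θ * Ek := by
            simp only [Finset.sum_const, Finset.card_univ, Fintype.card_fin, nsmul_eq_mul]
            push_cast
            ring
    calc ‖eulerForm (𝒜.slot 0 θ f) (𝒜.slot 1 θ f) (𝒜.slot 2 θ (heat σ w))‖ₑ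
        ≤ ENNReal.ofReal (2 * π) * (Cs * Sf 0 ns θ * Mf) * (Cs * Sf 1 ns θ * Mf) *
            (9 * Cg * Sf 2 ng θ * Ek) := by
          refine hE.trans ?_
          gcongr
          · exact hslot 0
          · exact hslot 1
      _ = c * Mf ^ 2 * Ek * (Sf 0 ns θ * Sf 1 ns θ * Sf 2 ng θ) := by
          rw [hc]; ring
  -- integrate
  unfold AveragingDatum.form
  refine (enorm_integral_le_lintegral_enorm _).trans ?_
  calc ∫⁻ θ, ‖eulerForm (𝒜.slot 0 θ f) (𝒜.slot 1 θ f) (𝒜.slot 2 θ (heat σ w))‖ₑ ∂𝒜.μ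
      ≤ ∫⁻ θ, c * Mf ^ 2 * Ek * (Sf 0 ns θ * Sf 1 ns θ * Sf 2 ng θ) ∂𝒜.μ := lintegral_mono hpt
    _ = c * Mf ^ 2 * Ek * Mom := by
        have hprod : Measurable fun θ => Sf 0 ns θ * Sf 1 ns θ * Sf 2 ng θ :=
          ((hSfm 0 ns).mul (hSfm 1 ns)).mul (hSfm 2 ng)
        rw [hMom, lintegral_const_mul _ hprod]
    _ = c * Mom * Mf ^ 2 * Ek := by ring

/-! ### The blocks of the Duhamel term -/

/-- **Blockwise bound of the Duhamel term of a mild solution.** Let `u` be a mild `H¹⁰_df` solution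
of the averaged equation of `𝒜` on `[0,T)`, `0 ≤ t₁ ≤ t < T`, with `‖u(s)‖_{Ḃ⁰_{∞,1}} ≤ M` on
`[t₁, t]`, and let `K` satisfy the key bilinear estimate of `FA.exists_enorm_form_heat_test_le`. Then
for every `k ∈ ℤ`
`‖Δ̇_k (u(t) - e^{(t-t₁)Δ}u(t₁))‖_{L^∞} ≤ 3 ∫_{t₁}^{t} K M² 2ᵏ e^{-(π²/8)(t-s)4ᵏ} ds`
(the blocks are read through the test fields `w_{k,x,i}` of part VI and the restarted Duhamel
identity of part Duhamel of stub F). -/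
theorem eLpNormDistrib_lpBlock_duhamel_le (𝒜 : AveragingDatum) {K : ℝ≥0∞}
    (hK : ∀ (f : L2C), MemH10df f → ∀ (Mf : ℝ≥0∞),
      eHomBesovNorm 0 ∞ 1 ((f : L2C) : 𝓢'(EuclideanSpace ℝ (Fin 3), EuclideanSpace ℂ (Fin 3))) ≤ Mf →
      ∀ (σ : ℝ), 0 ≤ σ → ∀ (k : ℤ) (x : EuclideanSpace ℝ (Fin 3)) (i : Fin 3) (w : L2C),
      (fourierFn w =ᵐ[volume] fun η : EuclideanSpace ℝ (Fin 3) =>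
        ((𝐞 (-⟪x, η⟫) : ℂ) * dyadicSymbol k η) •
          (EuclideanSpace.single i (1 : ℂ) -
            (EuclideanSpace.complexify η i / ((‖η‖ ^ 2 : ℝ) : ℂ)) • EuclideanSpace.complexify η)) →
      ‖𝒜.form f f (heat σ w)‖ₑ ≤
        K * Mf ^ 2 * ENNReal.ofReal ((2 : ℝ) ^ k * Real.exp (-(π ^ 2 / 8) * (σ * ((2 : ℝ) ^ k) ^ 2))))
    {a : L2C} {T : ℝ} {u : ℝ → L2C} (hu : IsMildSolutionFor 𝒜.form a (Ico 0 T) u)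
    {t₁ t M : ℝ} (ht₁ : 0 ≤ t₁) (ht₁t : t₁ ≤ t) (htT : t < T)
    (hB : ∀ s ∈ Icc t₁ t, eHomBesovNorm 0 ∞ 1 ((u s : L2C) :
      𝓢'(EuclideanSpace ℝ (Fin 3), EuclideanSpace ℂ (Fin 3))) ≤ ENNReal.ofReal M) (k : ℤ) :
    eLpNormDistrib ∞ (lpBlock k ((u t - heat (t - t₁) (u t₁) : L2C) :
      𝓢'(EuclideanSpace ℝ (Fin 3), EuclideanSpace ℂ (Fin 3)))) ≤
      3 * ∫⁻ s in Set.Ioo t₁ t, K * ENNReal.ofReal M ^ 2 *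
        ENNReal.ofReal ((2 : ℝ) ^ k * Real.exp (-(π ^ 2 / 8) * ((t - s) * ((2 : ℝ) ^ k) ^ 2))) := by
  have htI : t ∈ Ico 0 T := ⟨ht₁.trans ht₁t, htT⟩
  have ht₁I : t₁ ∈ Ico 0 T := ⟨ht₁, ht₁t.trans_lt htT⟩
  have hD : MemH10df (u t - heat (t - t₁) (u t₁)) := (hu.1 t htI).sub ((hu.1 t₁ ht₁I).heat _)
  refine eLpNormDistrib_lpBlock_coe_le_of_pairing k _ hD.2.2 fun x i w hw hFw => ?_
  -- the pairing through the restarted Duhamel identity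
  have hpair : pairing (u t - heat (t - t₁) (u t₁)) w =
      ∫ s in t₁..t, 𝒜.form (u s) (u s) (heat (t - s) w) := by
    rw [pairing_sub_left, F.pairing_eq_restart 𝒜 hu ht₁ ht₁t htT hw]
    ring
  rw [hpair, intervalIntegral.integral_of_le ht₁t]
  refine (enorm_integral_le_lintegral_enorm _).trans ?_
  rw [← restrict_Ioo_eq_restrict_Ioc]
  refine setLIntegral_mono' measurableSet_Ioo fun s hs => ?_
  have hsI : s ∈ Ico 0 T := ⟨ht₁.trans hs.1.le, hs.2.trans htT⟩
  exact hK (u s) (hu.1 s hsI) _ (hB s ⟨hs.1.le, hs.2.le⟩) (t - s) (sub_nonneg.2 hs.2.le) k x i w hFw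

end Summit.NavierStokesRegularity.NavierStokesRegularity.Theorems.PerpetualPumpThesis.FA

namespace Summit.NavierStokesRegularity.NavierStokesRegularity.Theorems.PerpetualPumpThesis

open Literature.Analysis.FluidPDE Literature.Analysis.FluidPDE.Tao2016
open Literature.Analysis.FunctionSpaces

/-- **Part Nonlinear of stub `besovDuhamelBound` (registered sub-goal `stub_FA_Nonlinear`)**: the
key bilinear estimate of the Besov–Duhamel bound for an arbitrary averaging datum,
`|⟨B̃(f,f), e^{σΔ} w_{k,x,i}⟩| ≤ K ‖f‖²_{Ḃ⁰_{∞,1}} 2ᵏ e^{-(π²/8) σ 4ᵏ}` with `K < ∞` (Euler form in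
physical space, slots `Ḃ⁰_{∞,1} → L^∞`, the test kernels, Tao's moment bounds). -/
theorem stub_FA_Nonlinear : ∀ 𝒜 : AveragingDatum, ∃ K : ENNReal, K ≠ ⊤ ∧ ∀ (f : L2C), MemH10df f → ∀ (Mf : ENNReal), eHomBesovNorm 0 ⊤ 1 ((f : L2C) : 𝓢'(EuclideanSpace ℝ (Fin 3), EuclideanSpace ℂ (Fin 3))) ≤ Mf → ∀ (σ : ℝ), 0 ≤ σ → ∀ (k : ℤ) (x : EuclideanSpace ℝ (Fin 3)) (i : Fin 3) (w : L2C), (fourierFn w =ᵐ[volume] fun η : EuclideanSpace ℝ (Fin 3) => (((Real.fourierChar (-(inner ℝ x η)) : Circle) : ℂ) * dyadicSymbol k η) • (EuclideanSpace.single i (1 : ℂ) - (EuclideanSpace.complexify η i / ((‖η‖ ^ 2 : ℝ) : ℂ)) • EuclideanSpace.complexify η)) → ‖𝒜.form f f (heat σ w)‖ₑ ≤ K * Mf ^ 2 * ENNReal.ofReal ((2 : ℝ) ^ k * Real.exp (-(Real.pi ^ 2 / 8) * (σ * ((2 : ℝ) ^ k) ^ 2))) :=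
  fun 𝒜 => FA.exists_enorm_form_heat_test_le 𝒜

end Summit.NavierStokesRegularity.NavierStokesRegularity.Theorems.PerpetualPumpThesis
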